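import Summits.Schanuel.Schanuel.Theorems.RootDecomp1KB3KirbyTrace02

/-!
# RootDecomp1KB3KirbyTrace — lens 6, generation 25, node 2 «THE LIOUVILLE SIDE OF 1K LIVES ON KIRBY'S COUNTABLE CORE» (CLAIM L2330, PRICE + CHECKLIST G30-α L2334, NODE L2341, critic VERDICT L2344: CLEARED THEOREM ×1 = CONDITIONAL CORE-COLLAPSE CERTIFICATE, moves no item, rung 0; PORT GO L2346) — continuation (RootDecomp1KB3KirbyTrace03): §6 the residual alone decides modulo 3817 (†), §7 (†′) under 3815 and item 3818 proved, §8 T5 B₃ ⟸ 3816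

(lens-6 g25b HOME kernel K2 = HOME/decomp-schanuel-lens-6/g25/B3KirbyTrace.lean 507fd15c…, 722 l, imports Theses RootDecomp1K / DiophantineCore / EclCore + Theorems RootDecomp1KHyper16 / RootDecomp1KGeneric02 / RootDecomp1EssentialInEclCore + six Literature Kirby/ecl/Diaz modules; P2/C2 + NODE-g25b.md 734c3ad1…. Port by census-1 gen 20 as `RootDecomp1KB3KirbyTrace01–03`: 01 = §1 the countable core `E = ecl ∅` (`span_le_E`), §2 measures vs the route's cut predicates (`measure_pow_of_poly`, `not_linLiouville_of_measure`, `not_hyperLinLiouville_of_measure`, `not_liouville_of_pair_measure`), §3 the crux 3817 on the core (`khovanskii_witness`, `measure_of_bakerOnE`, `not_linLiouville_of_bakerOnE`, `not_hyperLinLiouville_of_bakerOnE`, `not_liouville_coord_of_bakerOnE`, `not_coordLiouvilleSpan_of_bakerOnE`, price tag `not_liouville_exp_exp_one_of_bakerOnExpAlgebraic`); 02 = §4 the pointwise Kirby trace (`sb_of_eclTrace`, KNOWN Kirby 2010 Prop 7.2 / KNOWN-IN-TREE item 24395 `essentialCounterexamplesInEcl_core` BY NAME) + §5 the four items restricted to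 `E` (`…OnE`), `schanuel_of_piecesOnE`, heredity (`linLiouville_of_lattice`, `linLiouville_of_spanQ`, `polyMeasure_hered`, `coordClause_hered`) and the ONE iff `polyDiophantineSchanuelOnE_iff : B₃ᴱ ↔ B₃`; 03 = §6 (†) `schanuel_of_bakerOnExpAlgebraic_of_polyDiophantineSchanuel : BakerOnExpAlgebraic → PolyDiophantineSchanuel → Schanuel`, `aPiecesOnE_of_bakerOnExpAlgebraic`, §7 (†′) `schanuel_of_thOnExpAlgebraic_of_piecesOnE`, `bakerOnExpAlgebraicImpTH_holds : BakerOnExpAlgebraicImpTH` (item stmt-Schanuel-3818 of route DiophantineCore, PROVED), §8 T5 `polyDiophantineSchanuel_of_schanuelUnderTH : SchanuelUnderTH → PolyDiophantineSchanuel`.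
PORT EDITS (census g20): the §1 membership one-liners (`zero/one/add/sub/mul/div/exp/ratCast/natCast/two_mem_E`, `I_mem_E`, `conj_mem_E`, `re_mem_E`, `im_mem_E`, `exp_exp_one_mem_E`, `mem_eclSubfield_iff`), `linearIndependent_one_of_irrational` and the read-back `schanuel_iff_eclcoreThesis` are `private` (dedup-safety: tree twins `AclSubsetLogFreeCore/Negative/CoreAut*` `sub_mem_ecl_empty` / `I_mem_ecl_empty` / `conj_mem_ecl_empty` / `ofReal_re_mem_ecl_empty` / `ofReal_im_mem_ecl_empty` / `ratCast_mem_ecl_empty` / `cexp_mem_ecl_empty`, `RootDecomp1PillayTupleExpE.expE_mem_ecl`, `RootDecomp1BRadicalDescent.linearIndependent_one_of_irrational`); K's two auxiliary data definitions `conjExpHom` (+ `conjExpHom_apply`) and `eclSubmoduleQ` are INLINED into the proofs of `conj_mem_E` / `span_le_E` (no `def` outside §5); the unused `intCast_mem_E` is dropped; the four `…OnE` restricted-item definitions carry the «[restriction] definition» docstring tag; all other statements and proofs verbatim. Parts 01/02 `--supports stmt-Schanuel-31987` (the residual), part 03 `--workitem stmt-Schanuel-3818` (it proves that support item of route DiophantineCore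 by name) if the gate accepts, else `--supports`; no census credit carried; rung 0 — nothing here proves Schanuel.)
-/

noncomputable section

open Complex IntermediateField Finset
open scoped BigOperators

namespace Summit.Schanuel.Schanuel.Theorems.RootDecomp1KB3KirbyTrace

open Literature.NumberTheory.Transcendental
open Literature.ModelTheory.ExponentialFields (ExponentialRing ExponentialRingHom)
open Summit.Schanuel.Schanuel.Theses.RootDecomp1K (PolyDiophantineSchanuel CoordLiouvilleSchanuel
  HyperLiouvilleSchanuel FiniteOrderLiouvilleSchanuel LinLiouvilleSchanuel StrictDiophantineSchanuel)
open Summit.Schanuel.Schanuel.Theses.DiophantineCore (BakerOnExpAlgebraic THOnExpAlgebraic SchanuelUnderTH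
  BakerOnExpAlgebraicImpTH)
open Summit.Schanuel.Schanuel.Theses.EclCore (EclcoreThesis)
open Summit.Schanuel.Schanuel.Theorems.RootDecomp1EssentialInEclCore (essentialCounterexamplesInEcl_core)
open Summit.Schanuel.Schanuel.Theorems.RootDecomp1KGeneric (not_technicalHypothesis_of_hyperLinLiouville)
open Summit.Schanuel.Schanuel.Theorems.RootDecomp1KHyper (LinLiouville CoordLiouvilleSpan one_le_hsum
  hsum_nonneg exists_half_pow_le exists_le_two_pow linLiouville_of_liouville_ratio)
open Summit.Schanuel.Schanuel.Theorems.RootDecomp1KHyper.HyperCell (HyperLinLiouville)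

/-! ### §6  Under 3817 the Liouville-side items are vacuous on the core; the residual alone decides -/

/-- Under 3817 the coordinate-Liouville piece `A₁ᴱ` is vacuously true on the core. -/
theorem coordLiouvilleSchanuelOnE_of_bakerOnExpAlgebraic (hA : BakerOnExpAlgebraic) :
    CoordLiouvilleSchanuelOnE :=
  fun _ _ _ hzE h => absurd h (not_coordLiouvilleSpan_of_bakerOnE hA hzE)

/-- Under 3817 the hyper-Liouville piece `A₂ʰᴱ` is vacuously true on the core. -/
theorem hyperLiouvilleSchanuelOnE_of_bakerOnExpAlgebraic (hA : BakerOnExpAlgebraic) :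
    HyperLiouvilleSchanuelOnE :=
  fun _ _ hz hzE hyp => absurd hyp (not_hyperLinLiouville_of_bakerOnE hA hzE hz)

/-- Under 3817 the finite-order piece `A₂ᵈᴱ` is vacuously true on the core. -/
theorem finiteOrderLiouvilleSchanuelOnE_of_bakerOnExpAlgebraic (hA : BakerOnExpAlgebraic) :
    FiniteOrderLiouvilleSchanuelOnE :=
  fun _ _ hz hzE hLF _ => absurd hLF (not_linLiouville_of_bakerOnE hA hzE hz)

/-- **Deciding theorem on the core (†).**  `BakerOnExpAlgebraic → PolyDiophantineSchanuel → Schanuel`: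
modulo the Diophantine crux 3817 of route `DiophantineCore`, the residual B₃ of route `RootDecomp1K`
ALONE carries the summit — every `ℚ`-free `E`-tuple is in B₃'s scope, and `E`-tuples suffice (Kirby). -/
theorem schanuel_of_bakerOnExpAlgebraic_of_polyDiophantineSchanuel (hA : BakerOnExpAlgebraic)
    (hB : PolyDiophantineSchanuel) : _root_.Schanuel :=
  schanuelConjecture_iff_ecl_empty_holds.mpr fun n z hzE hz =>
    hB n z hz (not_coordLiouvilleSpan_of_bakerOnE hA hzE) (not_linLiouville_of_bakerOnE hA hzE hz)

/-- (†) through the restricted pieces: the same theorem assembled by `schanuel_of_piecesOnE`. -/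
theorem schanuel_of_bakerOnExpAlgebraic_of_polyDiophantineSchanuelOnE (hA : BakerOnExpAlgebraic)
    (hB : PolyDiophantineSchanuelOnE) : _root_.Schanuel :=
  schanuel_of_piecesOnE (coordLiouvilleSchanuelOnE_of_bakerOnExpAlgebraic hA)
    (hyperLiouvilleSchanuelOnE_of_bakerOnExpAlgebraic hA)
    (finiteOrderLiouvilleSchanuelOnE_of_bakerOnExpAlgebraic hA) hB

/-- Converse bookkeeping: Schanuel gives every restricted piece (so (†) loses nothing). -/
theorem piecesOnE_of_schanuel (h : _root_.Schanuel) :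
    CoordLiouvilleSchanuelOnE ∧ HyperLiouvilleSchanuelOnE ∧ FiniteOrderLiouvilleSchanuelOnE ∧
      PolyDiophantineSchanuelOnE :=
  ⟨fun n z hz _ _ => h n z hz, fun n z hz _ _ => h n z hz, fun n z hz _ _ _ => h n z hz,
    fun n z hz _ _ _ => h n z hz⟩

/-- Modulo 3817, Schanuel ⟺ the residual ⟺ the residual on the core. -/
theorem schanuel_iff_polyDiophantineSchanuel_of_bakerOnExpAlgebraic (hA : BakerOnExpAlgebraic) :
    (_root_.Schanuel ↔ PolyDiophantineSchanuel) ∧ (_root_.Schanuel ↔ PolyDiophantineSchanuelOnE) :=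
  ⟨⟨fun h n z hz _ _ => h n z hz, schanuel_of_bakerOnExpAlgebraic_of_polyDiophantineSchanuel hA⟩,
    ⟨fun h => (piecesOnE_of_schanuel h).2.2.2,
      schanuel_of_bakerOnExpAlgebraic_of_polyDiophantineSchanuelOnE hA⟩⟩

/-- T4 packaged: under 3817 the three Liouville-side items are VACUOUS ON THE CORE. (`A₂ʰᴱ`, `A₂ᵈᴱ` die
by §2–§3 alone; `A₁ᴱ` needs §1's `Re`, `Im ∈ E` — conjugation-stability of `E`.) -/
theorem aPiecesOnE_of_bakerOnExpAlgebraic (hA : BakerOnExpAlgebraic) :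
    CoordLiouvilleSchanuelOnE ∧ HyperLiouvilleSchanuelOnE ∧ FiniteOrderLiouvilleSchanuelOnE :=
  ⟨coordLiouvilleSchanuelOnE_of_bakerOnExpAlgebraic hA, hyperLiouvilleSchanuelOnE_of_bakerOnExpAlgebraic hA,
    finiteOrderLiouvilleSchanuelOnE_of_bakerOnExpAlgebraic hA⟩

/-! ### §7  The sharper theorem: under the WEAKER live crux 3815 (T.H. on the core) -/

/-- 3815 at a `ℚ`-free `E`-tuple: Diaz's Technical Hypothesis, in the catalogued spelling
`Literature.Barriers.Schanuel.TechnicalHypothesis` (3815 inlines it; `rfl`). -/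
theorem technicalHypothesis_of_thOnE (hT : THOnExpAlgebraic) {n : ℕ} {z : Fin n → ℂ}
    (hz : ∀ i, z i ∈ ecl (∅ : Set ℂ)) (hli : LinearIndependent ℚ z) :
    Literature.Barriers.Schanuel.TechnicalHypothesis z :=
  hT n z (fun i => khovanskii_witness (hz i)) hli

/-- **Under 3815 no `ℚ`-free `E`-tuple is hyper-Liouville** (T.H. excludes hyper-Liouville relations:
the tree's `RootDecomp1KGeneric.not_technicalHypothesis_of_hyperLinLiouville`, ε = 1). -/
theorem not_hyperLinLiouville_of_TH (hT : THOnExpAlgebraic) {n : ℕ} {z : Fin n → ℂ}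
    (hz : ∀ i, z i ∈ ecl (∅ : Set ℂ)) (hli : LinearIndependent ℚ z) : ¬ HyperLinLiouville z :=
  fun hH => not_technicalHypothesis_of_hyperLinLiouville hH (technicalHypothesis_of_thOnE hT hz hli)

/-- Under 3815 the hyper piece is vacuous on the core. -/
theorem hyperLiouvilleSchanuelOnE_of_thOnExpAlgebraic (hT : THOnExpAlgebraic) :
    HyperLiouvilleSchanuelOnE :=
  fun _ _ hz hzE hyp => absurd hyp (not_hyperLinLiouville_of_TH hT hzE hz)

/-- **(†′) Deciding theorem on the core under T.H.-strength.**
`THOnExpAlgebraic → A₁ᴱ → A₂ᵈᴱ → PolyDiophantineSchanuel → Schanuel`: under 3815 the HYPER piece dies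
on the core, while the coordinate-Liouville piece `A₁ᴱ` and the finite-order piece `A₂ᵈᴱ` SURVIVE as
hypotheses (T.H. tolerates sub-polynomial super-exponential approximations). -/
theorem schanuel_of_thOnExpAlgebraic_of_piecesOnE (hT : THOnExpAlgebraic)
    (h₁ : CoordLiouvilleSchanuelOnE) (hF : FiniteOrderLiouvilleSchanuelOnE)
    (hB : PolyDiophantineSchanuel) : _root_.Schanuel :=
  schanuel_of_piecesOnE h₁ (hyperLiouvilleSchanuelOnE_of_thOnExpAlgebraic hT) hF
    (polyDiophantineSchanuelOnE_of hB)

/-- **Item 3818 `BakerOnExpAlgebraicImpTH` (route DiophantineCore, support, «provable-now») PROVED**: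
`BakerOnExpAlgebraic → THOnExpAlgebraic`, literally the tree's
`Literature.NumberTheory.Transcendental.TechnicalHypothesis.of_lowerBound` after unfolding. -/
theorem bakerOnExpAlgebraicImpTH_holds : BakerOnExpAlgebraicImpTH := by
  intro hA n x hx hli
  obtain ⟨c, hc, k, hb⟩ := hA n x hx hli
  exact Literature.NumberTheory.Transcendental.TechnicalHypothesis.of_lowerBound hc hb

/-- (†) = (†′) ∘ 3818 ∘ (3817 ⇒ A₁ᴱ ∧ A₂ᵈᴱ): the two deciding theorems agree. -/
theorem schanuel_of_bakerOnExpAlgebraic_of_polyDiophantineSchanuel' (hA : BakerOnExpAlgebraic)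
    (hB : PolyDiophantineSchanuel) : _root_.Schanuel :=
  schanuel_of_thOnExpAlgebraic_of_piecesOnE (bakerOnExpAlgebraicImpTH_holds hA)
    (aPiecesOnE_of_bakerOnExpAlgebraic hA).1 (aPiecesOnE_of_bakerOnExpAlgebraic hA).2.2 hB

/-! ### §8  The residual sits under Waldschmidt's Conjecture 2.3 (the LIVE 3816), by name -/

/-- A measure in the route's spelling gives a polynomial lower bound in the spelling of
`TechnicalHypothesis.of_lowerBound` (`(1+S)^ω ≤ 2^ω S^ω` for `S ≥ 1`). -/
theorem polyLower_of_measure {n : ℕ} {z : Fin n → ℂ} {ω : ℕ}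
    (hm : ∀ h : Fin n → ℤ, h ≠ 0 → 1 / (1 + ∑ i, (|h i| : ℝ)) ^ ω ≤ ‖∑ i, (h i : ℂ) * z i‖) :
    ∀ h : Fin n → ℤ, h ≠ 0 →
      1 / (2 : ℝ) ^ ω ≤ (∑ i, (|h i| : ℝ)) ^ ω * ‖∑ i, (h i : ℂ) * z i‖ := by
  intro h hh
  have hS1 : 1 ≤ ∑ i, (|h i| : ℝ) := one_le_hsum hh
  have h1 : (1 + ∑ i, (|h i| : ℝ)) ^ ω ≤ (2 : ℝ) ^ ω * (∑ i, (|h i| : ℝ)) ^ ω := by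
    rw [← mul_pow]; exact pow_le_pow_left₀ (by positivity) (by linarith) ω
  have h2 := hm h hh
  rw [div_le_iff₀ (by positivity)] at h2 ⊢
  calc (1 : ℝ) ≤ ‖∑ i, (h i : ℂ) * z i‖ * (1 + ∑ i, (|h i| : ℝ)) ^ ω := h2
    _ ≤ ‖∑ i, (h i : ℂ) * z i‖ * ((2 : ℝ) ^ ω * (∑ i, (|h i| : ℝ)) ^ ω) :=
        mul_le_mul_of_nonneg_left h1 (norm_nonneg _)
    _ = (∑ i, (|h i| : ℝ)) ^ ω * ‖∑ i, (h i : ℂ) * z i‖ * 2 ^ ω := by ring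

/-- **A tuple that is NOT linearly Liouville satisfies Diaz's (T.H.)** — the tree's
`TechnicalHypothesis.of_lowerBound` BY NAME, fed with the measure `not_linLiouville_iff_measure`. -/
theorem technicalHypothesis_of_not_linLiouville {n : ℕ} {z : Fin n → ℂ} (hL : ¬ LinLiouville z) :
    Literature.NumberTheory.Transcendental.TechnicalHypothesis z := by
  obtain ⟨ω, hm⟩ := not_linLiouville_iff_measure.mp hL
  exact Literature.NumberTheory.Transcendental.TechnicalHypothesis.of_lowerBound
    (by positivity : (0 : ℝ) < 1 / 2 ^ ω) (polyLower_of_measure hm)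

/-- **T5. `SchanuelUnderTH → PolyDiophantineSchanuel`**: the residual B₃ lies under Waldschmidt's
Conjecture 2.3 = the LIVE item 3816 of route DiophantineCore (its (T.H.) binder is the inlined
`TechnicalHypothesis`, `rfl`). With node 1: `AlgIndepLogarithms ⟸ B₃ ⟸ 3816`, by name. -/
theorem polyDiophantineSchanuel_of_schanuelUnderTH (h : SchanuelUnderTH) : PolyDiophantineSchanuel :=
  fun n z hz _ hL => h n z hz (technicalHypothesis_of_not_linLiouville hL)

end Summit.Schanuel.Schanuel.Theorems.RootDecomp1KB3KirbyTrace

end
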